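import Summits.BirchSwinnertonDyer.Rank1Residual.X11b.UnrSeriesValueRigidity
import HarnessLib

set_option linter.dupNamespace false -- `Summit.BirchSwinnertonDyer.BirchSwinnertonDyer.Theorems.…` (summit = sub)
set_option autoImplicit false

/-! # Route `CongruentShaFreeCut` (rung S2) — `p`-ADIC HELPERS for LEMMA R∞ part (i): the RATE of the
# character supply (`‖x₀^{p^k} − 1‖ = C₀·‖p‖^k` eventually), double-exponential growth, the identity
# principle on `R₀⟦T⟧`

Cell `bsd-cn100`, prover seat `bsd-cn100-transfer-2` (g6). File 1 of 2 (file 2 =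
`Theorems/CongruentShaFreeCutBDPUpToNonUnimodular.lean`, the abstract core and the ♯-frame statement);
split for the 400-line rule. Supports, does not close, stmt-BirchSwinnertonDyer-19079. HONEST FRAMING:
elementary `p`-adic analysis on `ℂ_p` and `R₀⟦T⟧` over the tree's value API (`UnrSeries.HasValueAt`,
`…X11b.Halves.norm_value_sub_constantCoeff_le`, `…norm_value_eq_of_order`); nothing about BSD.

* `norm_value_le_one` — `‖L(x)‖ ≤ 1` for `L ∈ R₀⟦T⟧`, `‖x‖ < 1`;
* `norm_one_add_pow_sub_one_le` — `‖(1+y)^n − 1‖ ≤ ‖y‖` (`‖y‖ ≤ 1`);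
* `norm_one_add_pow_prime_sub_one` — `‖(1+y)^p − 1‖ = ‖p‖·‖y‖` (`‖y‖ < ‖p‖`);
* `exists_norm_pow_prime_pow_sub_one_eq` — for `x₀` with `x₀^{p^k} ≠ 1`, `x₀^{p^k} → 1`: eventually
  `‖x₀^{p^k} − 1‖ = C₀·‖p‖^k`, `C₀ > 0`;
* `mul_succ_le_two_pow`, `exists_lt_pow_prime_pow` — `A·R^k < b^{p^k}` eventually (`b > 1`);
* `eq_zero_of_hasValueAt_zero` — a series vanishing along `T_k → 0`, `T_k ≠ 0`, is `0`.

References: [Washington1997] L. C. Washington, *Introduction to Cyclotomic Fields*, §5.1;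
[Cassels1986] J. W. S. Cassels, *Local Fields*, Ch. 4 (values and zeros of power series). -/

noncomputable section

open scoped Classical Topology

open Filter PowerSeries
open Literature.NumberTheory.EllipticCurves

namespace Summit.BirchSwinnertonDyer.BirchSwinnertonDyer.Theorems.CongruentShaFreeCutPadicSupplyRate

open Summit.BirchSwinnertonDyer.Rank1Residual.X11b.Halves

variable {p : ℕ} [Fact p.Prime]

/-! ### §1 `p`-adic helpers -/

/-- **`‖L(x)‖ ≤ 1` on the open unit disc** for `L ∈ R₀⟦T⟧` (`‖L(x) − L(0)‖ ≤ ‖x‖`, `‖R₀‖ ≤ 1`).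
[cite: Cassels1986, Ch. 4 Lemma 2.1] -/
theorem norm_value_le_one {L : UnrSeries p} {x v : ℂ_[p]} (hx : ‖x‖ < 1) (hv : L.HasValueAt x v) :
    ‖v‖ ≤ 1 := by
  set c : ℂ_[p] := ((PowerSeries.constantCoeff L : unrIntegers p) : ℂ_[p]) with hc
  have h1 : ‖v - c‖ ≤ ‖x‖ := norm_value_sub_constantCoeff_le hx hv
  have h2 : ‖c‖ ≤ 1 := norm_coe_unrIntegers_le_one p _
  calc ‖v‖ = ‖(v - c) + c‖ := by rw [sub_add_cancel]
    _ ≤ max ‖v - c‖ ‖c‖ := IsUltrametricDist.norm_add_le_max _ _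
    _ ≤ 1 := max_le (h1.trans hx.le) h2

/-- `‖(1+y)^n − 1‖ ≤ ‖y‖` for `‖y‖ ≤ 1` (induction: `(1+y)^{n+1} − 1 = (1+y)((1+y)^n − 1) + y`,
`‖1+y‖ ≤ 1`). [cite: Washington1997, §5.1] -/
theorem norm_one_add_pow_sub_one_le {y : ℂ_[p]} (hy : ‖y‖ ≤ 1) (n : ℕ) :
    ‖(1 + y) ^ n - 1‖ ≤ ‖y‖ := by
  have h1y : ‖1 + y‖ ≤ 1 :=
    (IsUltrametricDist.norm_add_le_max 1 y).trans (max_le (by simp) hy)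
  induction n with
  | zero => simp
  | succ n ih =>
    have heq : (1 + y) ^ (n + 1) - 1 = (1 + y) * ((1 + y) ^ n - 1) + y := by ring
    rw [heq]
    calc ‖(1 + y) * ((1 + y) ^ n - 1) + y‖
        ≤ max ‖(1 + y) * ((1 + y) ^ n - 1)‖ ‖y‖ := IsUltrametricDist.norm_add_le_max _ _
      _ ≤ ‖y‖ := by
          refine max_le ?_ le_rfl
          rw [norm_mul]
          calc ‖1 + y‖ * ‖(1 + y) ^ n - 1‖ ≤ 1 * ‖y‖ := by gcongr
            _ = ‖y‖ := one_mul _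

/-- **`‖(1+y)^p − 1‖ = ‖p‖·‖y‖` for `‖y‖ < ‖p‖`**: `(1+y)^p − 1 = y·∑_{i<p}(1+y)^i` and
`∑_{i<p}(1+y)^i = p + ∑_{i<p}((1+y)^i − 1)` has norm exactly `‖p‖`, the correction having norm
`≤ ‖y‖ < ‖p‖`. [cite: Washington1997, §5.1] -/
theorem norm_one_add_pow_prime_sub_one {y : ℂ_[p]} (hy : ‖y‖ < ‖(p : ℂ_[p])‖) :
    ‖(1 + y) ^ p - 1‖ = ‖(p : ℂ_[p])‖ * ‖y‖ := by
  have hp1 : ‖(p : ℂ_[p])‖ ≤ 1 := IsUltrametricDist.norm_natCast_le_one ℂ_[p] p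
  have hy1 : ‖y‖ ≤ 1 := hy.le.trans hp1
  -- `(1+y)^p − 1 = (∑ (1+y)^i) · y`
  have hgeom : (1 + y) ^ p - 1 = (∑ i ∈ Finset.range p, (1 + y) ^ i) * y := by
    have h := geom_sum_mul (1 + y) p
    rw [add_sub_cancel_left] at h
    exact h.symm
  -- `∑ (1+y)^i = p + ∑ ((1+y)^i − 1)`
  have hsplit : (∑ i ∈ Finset.range p, (1 + y) ^ i) =
      (p : ℂ_[p]) + ∑ i ∈ Finset.range p, ((1 + y) ^ i - 1) := by
    rw [Finset.sum_sub_distrib, Finset.sum_const, Finset.card_range, nsmul_eq_mul, mul_one]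
    ring
  have hcorr : ‖∑ i ∈ Finset.range p, ((1 + y) ^ i - 1)‖ ≤ ‖y‖ :=
    IsUltrametricDist.norm_sum_le_of_forall_le_of_nonneg (norm_nonneg y)
      fun i _ ↦ norm_one_add_pow_sub_one_le hy1 i
  have hlt : ‖∑ i ∈ Finset.range p, ((1 + y) ^ i - 1)‖ < ‖(p : ℂ_[p])‖ := hcorr.trans_lt hy
  have hnorm : ‖∑ i ∈ Finset.range p, (1 + y) ^ i‖ = ‖(p : ℂ_[p])‖ := by
    rw [hsplit]
    calc ‖(p : ℂ_[p]) + ∑ i ∈ Finset.range p, ((1 + y) ^ i - 1)‖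
        = max ‖(p : ℂ_[p])‖ ‖∑ i ∈ Finset.range p, ((1 + y) ^ i - 1)‖ :=
          IsUltrametricDist.norm_add_eq_max_of_norm_ne_norm (ne_of_gt hlt)
      _ = ‖(p : ℂ_[p])‖ := max_eq_left hlt.le
  rw [hgeom, norm_mul, hnorm]

/-- **The RATE of the character supply**: for `x₀ ∈ ℂ_p` with `x₀^{p^k} ≠ 1` for all `k` and
`x₀^{p^k} → 1`, there are `k₀` and `C₀ > 0` with `‖x₀^{p^k} − 1‖ = C₀·‖p‖^k` for all `k ≥ k₀`
(once `‖x₀^{p^k} − 1‖ < ‖p‖`, each further `p`-th power multiplies the distance to `1` by exactly `‖p‖`).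
[cite: Washington1997, §5.1] -/
theorem exists_norm_pow_prime_pow_sub_one_eq {x₀ : ℂ_[p]} (hx1 : ∀ k : ℕ, x₀ ^ p ^ k ≠ 1)
    (hx : Tendsto (fun k : ℕ ↦ x₀ ^ p ^ k) atTop (𝓝 1)) :
    ∃ (k₀ : ℕ) (C₀ : ℝ), 0 < C₀ ∧ ∀ k : ℕ, k₀ ≤ k →
      ‖x₀ ^ p ^ k - 1‖ = C₀ * ‖(p : ℂ_[p])‖ ^ k := by
  have hp : p.Prime := Fact.out
  have hpnorm : 0 < ‖(p : ℂ_[p])‖ := norm_pos_iff.mpr (by exact_mod_cast hp.ne_zero)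
  -- eventually `‖x₀^{p^k} − 1‖ < ‖p‖`
  have hT0 : Tendsto (fun k : ℕ ↦ ‖x₀ ^ p ^ k - 1‖) atTop (𝓝 0) := by
    have h := (tendsto_iff_norm_sub_tendsto_zero).mp hx
    simpa using h
  obtain ⟨k₀, hk₀⟩ := (hT0.eventually_lt_const hpnorm).exists_forall_of_atTop
  -- the recursion above `k₀`
  have hrec : ∀ k, k₀ ≤ k → ‖x₀ ^ p ^ (k + 1) - 1‖ = ‖(p : ℂ_[p])‖ * ‖x₀ ^ p ^ k - 1‖ := by
    intro k hk
    have heq : x₀ ^ p ^ (k + 1) - 1 = (1 + (x₀ ^ p ^ k - 1)) ^ p - 1 := by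
      rw [add_sub_cancel, pow_succ, pow_mul]
    rw [heq]
    exact norm_one_add_pow_prime_sub_one (hk₀ k hk)
  -- closed form `‖x₀^{p^k} − 1‖ = ‖x₀^{p^{k₀}} − 1‖ · ‖p‖^{k − k₀}`
  have hclosed : ∀ j : ℕ, ‖x₀ ^ p ^ (k₀ + j) - 1‖ = ‖x₀ ^ p ^ k₀ - 1‖ * ‖(p : ℂ_[p])‖ ^ j := by
    intro j
    induction j with
    | zero => simp
    | succ j ih =>
      rw [← add_assoc, hrec (k₀ + j) (Nat.le_add_right _ _), ih, pow_succ]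
      ring
  have hpos : 0 < ‖x₀ ^ p ^ k₀ - 1‖ := norm_pos_iff.mpr (sub_ne_zero.mpr (hx1 k₀))
  refine ⟨k₀, ‖x₀ ^ p ^ k₀ - 1‖ / ‖(p : ℂ_[p])‖ ^ k₀, div_pos hpos (pow_pos hpnorm _), fun k hk ↦ ?_⟩
  obtain ⟨j, rfl⟩ := Nat.exists_eq_add_of_le hk
  rw [hclosed j, pow_add, div_mul_eq_mul_div, mul_comm (‖(p : ℂ_[p])‖ ^ k₀), ← mul_assoc,
    mul_div_assoc, div_self (pow_ne_zero _ hpnorm.ne'), mul_one]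

omit [Fact p.Prime] in
/-- `m·(k+1) ≤ 2^k` for `k ≥ 2m` (elementary). [folklore] -/
theorem mul_succ_le_two_pow (m : ℕ) : ∀ k : ℕ, 2 * m ≤ k → m * (k + 1) ≤ 2 ^ k := by
  -- base `k = 2m`: `m(2m+1) ≤ 4^m`; step: `2^{k+1} = 2·2^k ≥ 2m(k+1) ≥ m(k+2)`
  have hbase' : ∀ m : ℕ, m * (2 * m + 1) + 1 ≤ 2 ^ (2 * m) := by
    intro m
    induction m with
    | zero => simp
    | succ m ih =>
      have h4 : 2 ^ (2 * (m + 1)) = 4 * 2 ^ (2 * m) := by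
        rw [show 2 * (m + 1) = 2 * m + 2 by ring, pow_add]; ring
      rw [h4]
      nlinarith [ih, Nat.le_mul_self m]
  have hbase : ∀ m : ℕ, m * (2 * m + 1) ≤ 2 ^ (2 * m) := fun m ↦
    (Nat.le_succ _).trans (hbase' m)
  intro k hk
  obtain ⟨j, rfl⟩ := Nat.exists_eq_add_of_le hk
  induction j with
  | zero => simpa using hbase m
  | succ j ih =>
    have h1 : m * (2 * m + (j + 1) + 1) ≤ 2 * (m * (2 * m + j + 1)) := by nlinarith
    calc m * (2 * m + (j + 1) + 1) ≤ 2 * (m * (2 * m + j + 1)) := h1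
      _ ≤ 2 * 2 ^ (2 * m + j) := Nat.mul_le_mul_left 2 (ih (Nat.le_add_right _ _))
      _ = 2 ^ (2 * m + (j + 1)) := by rw [show 2 * m + (j + 1) = (2 * m + j) + 1 by ring, pow_succ]; ring

/-- **Double-exponential beats exponential**: for real `b > 1`, `A, R ≥ 0`, eventually
`A · R^k < b^{p^k}`. [folklore] -/
theorem exists_lt_pow_prime_pow {b A R : ℝ} (hb : 1 < b) (hA : 0 ≤ A) (hR : 0 ≤ R) :
    ∃ k₁ : ℕ, ∀ k : ℕ, k₁ ≤ k → A * R ^ k < b ^ p ^ k := by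
  have hp : p.Prime := Fact.out
  have hb0 : 0 < b := zero_lt_one.trans hb
  -- one exponent `m` dominating both `A` and `max R 1`
  set R' : ℝ := max R 1 with hR'
  have hR'1 : 1 ≤ R' := le_max_right _ _
  obtain ⟨m₁, hm₁⟩ := pow_unbounded_of_one_lt A hb
  obtain ⟨m₂, hm₂⟩ := pow_unbounded_of_one_lt R' hb
  set m : ℕ := max m₁ m₂ + 1 with hm
  have hm1 : m₁ ≤ m := (le_max_left _ _).trans (Nat.le_succ _)
  have hm2 : m₂ ≤ m := (le_max_right _ _).trans (Nat.le_succ _)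
  have hAm : A < b ^ m := hm₁.trans_le (pow_le_pow_right₀ hb.le hm1)
  have hRm : R' < b ^ m := hm₂.trans_le (pow_le_pow_right₀ hb.le hm2)
  refine ⟨2 * m, fun k hk ↦ ?_⟩
  -- `A R^k ≤ A R'^k < b^m (b^m)^k = b^{m(k+1)} ≤ b^{2^k} ≤ b^{p^k}`
  have hexp : m * (k + 1) ≤ p ^ k :=
    (mul_succ_le_two_pow m k hk).trans (Nat.pow_le_pow_left hp.two_le k)
  calc A * R ^ k ≤ A * R' ^ k := by gcongr; exact le_max_left _ _
    _ < b ^ m * (b ^ m) ^ k := by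
        have h1 : R' ^ k < (b ^ m) ^ k ∨ k = 0 := by
          rcases Nat.eq_zero_or_pos k with h0 | h0
          · exact Or.inr h0
          · exact Or.inl (pow_lt_pow_left₀ hRm (zero_le_one.trans hR'1) h0.ne')
        rcases h1 with h1 | h1
        · calc A * R' ^ k ≤ A * (b ^ m) ^ k := by gcongr
            _ < b ^ m * (b ^ m) ^ k := by gcongr
        · subst h1; simpa using hAm
    _ = b ^ (m * (k + 1)) := by rw [← pow_succ', ← pow_mul, mul_comm]
    _ ≤ b ^ p ^ k := pow_le_pow_right₀ hb.le hexp

/-- **Identity principle on `R₀⟦T⟧`**: a series taking the value `0` at points `T_k → 0`, `T_k ≠ 0`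
(for all large `k`), is the zero series (order lemma `…X11b.Halves.norm_value_eq_of_order`).
[cite: Cassels1986, Ch. 4 (zeros of power series on the open disc are isolated)] -/
theorem eq_zero_of_hasValueAt_zero {L : UnrSeries p} {T : ℕ → ℂ_[p]} {k₀ : ℕ}
    (hT0 : Tendsto T atTop (𝓝 0)) (hTne : ∀ k, k₀ ≤ k → T k ≠ 0)
    (hL : ∀ k, k₀ ≤ k → L.HasValueAt (T k) 0) : L = 0 := by
  by_contra hne
  set d : ℕ := L.order.toNat with hd
  set g₀ : ℂ_[p] := ((PowerSeries.coeff d L : unrIntegers p) : ℂ_[p]) with hg₀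
  have hg₀ne : g₀ ≠ 0 := by
    rw [hg₀, Ne, ZeroMemClass.coe_eq_zero, hd]
    exact PowerSeries.coeff_order hne
  have hTn : Tendsto (fun k ↦ ‖T k‖) atTop (𝓝 0) := tendsto_zero_iff_norm_tendsto_zero.mp hT0
  have E1 : ∀ᶠ k in atTop, ‖T k‖ < 1 := hTn.eventually_lt_const zero_lt_one
  have E2 : ∀ᶠ k in atTop, ‖T k‖ < ‖g₀‖ := hTn.eventually_lt_const (norm_pos_iff.mpr hg₀ne)
  have E3 : ∀ᶠ k in atTop, k₀ ≤ k := eventually_ge_atTop k₀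
  obtain ⟨k, h1, h2, h3⟩ := (E1.and (E2.and E3)).exists
  have h := norm_value_eq_of_order h1 h2 (hL k h3)
  rw [norm_zero] at h
  have hpos : 0 < ‖T k‖ ^ d * ‖g₀‖ :=
    mul_pos (pow_pos (norm_pos_iff.mpr (hTne k h3)) _) (norm_pos_iff.mpr hg₀ne)
  exact hpos.ne' h.symm


end Summit.BirchSwinnertonDyer.BirchSwinnertonDyer.Theorems.CongruentShaFreeCutPadicSupplyRate

end
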